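/-
Copyright: lead seat `ym-line-sll-p1` (prover-ym-line-sll-p1-g0-0), route `SoftLoopLongLag`, cruxes `ColdBoxSoftLoopLagFloor`
(stmt-QuantumFields-22503) and `SoftLoopLagFloorToTorus` (stmt-QuantumFields-22504).
-/
import Summits.QuantumFields.YangMills.Theorems.WeakCouplingRates

/-!
# Route `SoftLoopLongLag` — the objects of its two crux lines (`Cruxes/ColdBoxSoftLoopLagFloor/Lines/birth.lean`,
# `Cruxes/SoftLoopLagFloorToTorus/Lines/birth.lean`): the soft-loop observable, the lag box and its cold-conditioned
# DLR kernel, lag covariances (state / kernel / torus), crude-good data, and the free lattice-Maxwell inductance sums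

The route's cruxes (Theses file `Summits/QuantumFields/YangMills/Theses/SoftLoopLongLag.lean`) are typed with `let`-bound
abbreviations over tree objects only.  This file NAMES those abbreviations (every definition below is, up to `rfl`, a `let` of the
crux statements or a Gaussian bookkeeping sum over the tree's `curvatureTwoPoint`), so that the registered stubs of the two lines can
be landed BY NAME + SIGNATURE against tree declarations (the v0 skeletons carry byte-identical local copies; v1 imports this module) —
exactly as the sibling all-`G` route did with `Theorems/ColdBoxAllGroupsDefs.lean`.

* `timeZeroCube R` — the sites `x ∈ [-R, R]⁴` with `x₀ = 0`;
* `softLoopObs r R` — the cube-smeared time-zero soft-loop observable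
  `F_R(U) = Σ_{x ∈ timeZeroCube R} N⁻¹ Re tr r(hol_{R×R loop at x in the (1,2) plane}(U))` (verbatim the `F` of T′/K′/P);
* `lagBox n` — the edge box `Λ_n = [-n, n]⁴ × {all directions}`; `coldEvent r β κ Λ` — every plaquette touching `Λ` has cost
  `≤ β^{κ−1}`; `coldKernel r β κ n η` — the DLR kernel `ymSpecification r.ρ β Λ_n η` conditioned on the cold event (`ProbabilityTheory.cond`);
* `lagCov μ F t` — `Cov_μ(F, F∘α_t)`; `condMean r β κ n F η` — `∫ F d(coldKernel … η)`; `torusLagCov r β L F t` — the torus-state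
  (`wilsonExpectation`, side `L+1`, observables through the periodic lift) lag-`t` autocovariance, the shape of the leaf's `torusPlaqCov`;
* `CrudeGoodCorona r β δ n η` — every plaquette touching `Λ_n` has cost `≤ β^{2δ−1}` on the datum `η` (the analogue of
  `ColdBoxAllGroups.CrudeGoodG` for the centred box);
* `rectSurface x R T`, `mutualInductance x y R`, `wickLagSum R t` — the spanning surface of the `R×T` rectangle at `x` in the `(1,2)`
  plane, the free lattice-Maxwell mutual inductance `Σ_{p ∈ S(x), q ∈ S(y)} (d(−Δ)⁻¹d*)(p,q)` of two `R×R` squares (tree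
  `curvatureTwoPoint`, Garban–Sepúlveda's gradient spin-wave kernel on `ℤ⁴`), and the Wick floor sum
  `Σ_{x,x' ∈ timeZeroCube R} M(x, x' + t e₀; R)²` (the zero-background Gaussian leading term of `β²·Cov(F_R, F_R∘α_t)` up to the
  representation constant).

Design notes.  `d = 4` throughout; `G : Type` with the measurable structure an instance parameter (the cruxes instantiate `borel G`
only in the leaf); `r : LatticeRep G` explicit.  The predicates/objects are the LINES' vocabulary, not claims: nothing is asserted
here (two one-line lemmas only).  HONEST LABEL: the route serves the RECORD-label rung R2xi-G (leaf `WeakCouplingRates.XiPow`, an UPPER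
bound on the lattice mass gap for every compact simple `G`); it is NOT the Clay mass gap and proves no summit statement.

References: E. Seiler, LNP 159 (1982) Ch. 2 (DLR kernels of lattice gauge theory); H.-O. Georgii, *Gibbs Measures and Phase
Transitions* (2011) Def. 2.9; C. Garban, A. Sepúlveda, IMRN 2023, §2.3.3 (gradient spin-wave on 2-forms); S. Chatterjee,
arXiv:1803.01950 §4 (Wilson loops).
-/

set_option autoImplicit false

noncomputable section

open MeasureTheory Filter Topology
open Literature.Probability.LatticeModels (Site box)
open Literature.MathematicalPhysics Literature.MathematicalPhysics.QuantumFieldTheory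
open Literature.MathematicalPhysics.QuantumLattice
open Summit.QuantumFields.YangMills.Theorems.WeakCouplingRates

namespace Summit.QuantumFields.YangMills.Theorems.SoftLoopLongLag

section Objects

variable {G : Type} [Group G] [TopologicalSpace G] [IsTopologicalGroup G] [CompactSpace G]
  [MeasurableSpace G] [BorelSpace G]

/-- The time-zero cube of half-side `R`: the sites `x ∈ [-R, R]⁴` with `x₀ = 0` (base points of the smeared loops). -/
def timeZeroCube (R : ℕ) : Finset (Site 4) := (box 4 R).filter (fun x => x 0 = 0)

/-- The cube-smeared time-zero soft-loop observable
`F_R(U) = Σ_{x ∈ [-R,R]⁴, x₀ = 0} N⁻¹ Re tr r(hol_{R×R loop at x, plane (1,2)}(U))` — verbatim the `F` of the route's items. -/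
def softLoopObs (r : LatticeRep G) (R : ℕ) : LGConfig 4 G → ℝ := fun U =>
  ∑ x ∈ (box 4 R).filter (fun x => x 0 = 0),
    wilsonLoopObs (fun g : G => (r.N : ℝ)⁻¹ * (r.ρ g).trace.re) (rectWalk x 1 2 R R) U

omit [IsTopologicalGroup G] [CompactSpace G] [MeasurableSpace G] [BorelSpace G] in
/-- `softLoopObs` is the sum over `timeZeroCube`. -/
theorem softLoopObs_eq_sum (r : LatticeRep G) (R : ℕ) (U : LGConfig 4 G) :
    softLoopObs r R U = ∑ x ∈ timeZeroCube R,
      wilsonLoopObs (fun g : G => (r.N : ℝ)⁻¹ * (r.ρ g).trace.re) (rectWalk x 1 2 R R) U := rfl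

/-- The lag box `Λ_n`: all positively oriented edges of `ℤ⁴` based in `[-n, n]⁴`. -/
def lagBox (n : ℕ) : Finset (QuantumLattice.ZdEdge 4) := (box 4 n) ×ˢ Finset.univ

/-- The cold event at threshold `β^{κ−1}` for the edge set `Λ`: every plaquette touching `Λ` has cost `N − Re tr r(U_p) ≤ β^{κ−1}`. -/
def coldEvent (r : LatticeRep G) (β κ : ℝ) (Λ : Finset (QuantumLattice.ZdEdge 4)) : Set (LGConfig 4 G) :=
  {U | ∀ p ∈ plaquettesTouching Λ, (r.N : ℝ) - plaquetteObs r.ρ p.1 p.2.1.1 p.2.1.2 U ≤ β ^ (κ - 1)}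

/-- The cold-conditioned DLR kernel `ν_η = γ_{Λ_n}(· | η)[· | cold]` of the box `Λ_n` with boundary datum `η`
(tree `ymSpecification`, Mathlib `ProbabilityTheory.cond`). -/
def coldKernel (r : LatticeRep G) (β κ : ℝ) (n : ℕ) (η : LGConfig 4 G) : Measure (LGConfig 4 G) :=
  ProbabilityTheory.cond (ymSpecification (d := 4) r.ρ β (lagBox n) η) (coldEvent r β κ (lagBox n))

/-- The lag-`t` autocovariance `Cov_μ(F, F∘α_t) = ∫ F·(F∘α_t) dμ − ∫ F dμ · ∫ F∘α_t dμ` of an observable `F` in a state `μ` on `ℤ⁴`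
configurations (`α_t = timeShiftLG t`). -/
def lagCov (μ : Measure (LGConfig 4 G)) (F : LGConfig 4 G → ℝ) (t : ℕ) : ℝ :=
  (∫ U, F U * F (timeShiftLG (G := G) t U) ∂μ) - (∫ U, F U ∂μ) * (∫ U, F (timeShiftLG (G := G) t U) ∂μ)

/-- «crude-good» boundary datum for the box `Λ_n` at scale `β^{2δ−1}`: every plaquette touching `Λ_n` has cost `≤ β^{2δ−1}` on `η`
(the centred-box analogue of `ColdBoxAllGroups.CrudeGoodG`; a predicate of the K′ line, not a claim). -/
def CrudeGoodCorona (r : LatticeRep G) (β δ : ℝ) (n : ℕ) (η : LGConfig 4 G) : Prop :=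
  ∀ p ∈ plaquettesTouching (lagBox n), (r.N : ℝ) - plaquetteObs r.ρ p.1 p.2.1.1 p.2.1.2 η ≤ β ^ (2 * δ - 1)

/-- The conditional mean `m^ν_F(η) = ∫ F dν_η` of `F` under the cold-conditioned kernel with datum `η`. -/
def condMean (r : LatticeRep G) (β κ : ℝ) (n : ℕ) (F : LGConfig 4 G → ℝ) (η : LGConfig 4 G) : ℝ :=
  ∫ U, F U ∂(coldKernel r β κ n η)

/-- The torus-state lag-`t` autocovariance of `F` at volume `(L+1)⁴` and coupling `β` (observables read through the periodic lift
`toTorusObservable`, exactly as the leaf's `torusPlaqCov`). -/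
def torusLagCov (r : LatticeRep G) (β : ℝ) (L : ℕ) (F : LGConfig 4 G → ℝ) (t : ℕ) : ℝ :=
  wilsonExpectation (L := L + 1) r.ρ β (toTorusObservable (L + 1) fun U => F U * F (timeShiftLG (G := G) t U)) -
    wilsonExpectation (L := L + 1) r.ρ β (toTorusObservable (L + 1) F) *
      wilsonExpectation (L := L + 1) r.ρ β (toTorusObservable (L + 1) fun U => F (timeShiftLG (G := G) t U))

end Objects

section Gaussian

/-- The spanning surface of the `R × T` rectangle at `x` in the `(1,2)` plane of `ℤ⁴`: the plaquettes `(x + a e₁ + b e₂; 1, 2)`,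
`a < R`, `b < T` (the surface bounded by `rectWalk x 1 2 R T`). -/
def rectSurface (x : Site 4) (R T : ℕ) : Finset (ZdPlaquette 4) :=
  ((Finset.range R) ×ˢ (Finset.range T)).image fun ab : ℕ × ℕ =>
    ((x + Pi.single 1 (ab.1 : ℤ) + Pi.single 2 (ab.2 : ℤ), ⟨((1 : Fin 4), (2 : Fin 4)), by decide⟩) : ZdPlaquette 4)

/-- The free lattice-Maxwell mutual inductance of the `R×R` squares at `x` and `y` in the `(1,2)` plane: the flux–flux covariance
`Σ_{p ∈ S(x), q ∈ S(y)} (d(−Δ)⁻¹d*)(p, q)` of the massless `1`-form field on `ℤ⁴` (tree `curvatureTwoPoint`). -/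
def mutualInductance (x y : Site 4) (R : ℕ) : ℝ :=
  ∑ p ∈ rectSurface x R R, ∑ q ∈ rectSurface y R R, curvatureTwoPoint p q

/-- The Wick floor sum at lag `t`: `Σ_{x, x' ∈ timeZeroCube R} M(x, x' + t e₀; R)²` (every term a square). -/
def wickLagSum (R t : ℕ) : ℝ :=
  ∑ x ∈ timeZeroCube R, ∑ x' ∈ timeZeroCube R, mutualInductance x (x' + Pi.single 0 (t : ℤ)) R ^ 2

/-- `wickLagSum R t` is non-negative (a sum of squares). -/
theorem wickLagSum_nonneg (R t : ℕ) : 0 ≤ wickLagSum R t :=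
  Finset.sum_nonneg fun _ _ => Finset.sum_nonneg fun _ _ => sq_nonneg _

end Gaussian

end Summit.QuantumFields.YangMills.Theorems.SoftLoopLongLag

end
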